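import Summits.CriticalPhenomena.PercolationContinuityZ3.Theorems.PercNearOneGluingNoHeavyQuantSingleLowCells
import HarnessLib

/-!
# QUANT lane R8, T-DEC: the TWO-LOW CELLS of the Hoeffding reduction — `r` equal blobs at a lowered target `k·T'`, `2 < T' ≤ 4`: the two low
# atoms `0` and `k` are paid for by two disjoint windows of top atoms at the floor gate (prim-quant-census-2 gen 83, file 9)

builds on p205010 (kernel theorem, internal audit signed; external expert review pending)

Support file (`--supports stmt-CriticalPhenomena-4575`), QUANT lane census seat prim-quant-census-2 (gen 83); memo
`run/shared/lean/prim/quant/prim-quant-census-2-g83/HOEFFDING-G83.md` §2.  Theorems only, standard axioms, no sorries, no definitions.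

Companion of `heavy_binomial_singleLow_floor` (`…QuantSingleLowCells`).  In the cell `(m,r) = (1,7)`, `3/7 < g < 1/2` of the width-8
reduction the lowered target `T' = 7g − 1` exceeds `2`, so the atom `k` is low as well.  Certificate: pairs `{0, j·k; x}` for `J₀ ≤ j ≤ r` and
`{k, j·k; x}` for `J₁ ≤ j < J₀`, each window loaded uniformly (via `heavy_of_pairWeights`):
* `sum_lattice_window₂` — `Σ_{h ≤ r·k} [k ∣ h, J₁·k ≤ h < J₀·k]·μ h = Σ_{J₁ ≤ j < J₀} μ(j·k)`.
* **`heavy_binomial_twoLow_floor`** — law `blobLaw (replicate r (k,g))` (`0 < g < 1`), floor `0 < x < 1`, target `k·T'`, `2 < T' ≤ 4`; windows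
  `2 ≤ J₁ < J₀ ≤ r` with `T' ≤ x·J₀` and `T' − 2 ≤ x·(J₁ − 1)`; if `x·P(0) ≤ (1−x)·Σ_{J₀ ≤ j ≤ r} P(j·k)` and `x·P(k) ≤ (1−x)·Σ_{J₁ ≤ j < J₀} P(j·k)`
  then the law is heavy at `(x, k·T')` on `{0..r·k}`.

HONEST STATUS.  Tool for the cells; conjecture BLOB-AFL beyond the widths assembled, conjecture C, `SiblingStep`, `FarTreeRow`, `GluedLemmaW`,
`GluedDominatedMass` OPEN; RATE class (log\*) / honest sentence of `run/shared/lean/prim/quant/README.md` unchanged.  [this work].  Nothing here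
is cited as a published result.  The gluing rows served [cite: KozmaNitzan2024, Conjecture 3 (p. 15)]; product measure [cite: Grimmett1999, §1.3 p. 10].
-/

noncomputable section

open scoped BigOperators

namespace Summit.CriticalPhenomena.PercolationContinuityZ3.Theorems
namespace Quant

open Finset

/-- the two-point law `{lo, hi; g}` (as in `…QuantLawDEC`) -/
local notation3 "TP[" lo ", " hi ", " g ", " h "]" =>
  (g : ℝ) * (if (h : ℕ) = (hi : ℕ) then (1 : ℝ) else 0) + (1 - (g : ℝ)) * (if (h : ℕ) = (lo : ℕ) then (1 : ℝ) else 0)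

/-- a HEAVY decomposition of the law `μ` on `{0..M}` at floor `x`, target `T` (the inline `∃` consumed by `decAtT_of_heavy`) -/
local notation3 "HEAVY[" x ", " T ", " M ", " μ "]" =>
  ∃ (ι : Type) (_ : Fintype ι) (lam γ : ι → ℝ) (lo hi : ι → ℕ),
    (∀ i, 0 ≤ lam i) ∧ (∑ i, lam i = 1) ∧ (∀ i, 0 ≤ γ i ∧ γ i ≤ 1) ∧ (∀ i, lo i ≤ hi i) ∧ (∀ i, hi i ≤ (M : ℕ)) ∧
    (∀ h, (μ : ℕ → ℝ) h = ∑ i, lam i * TP[lo i, hi i, γ i, h]) ∧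
    (∀ i, 0 < lam i → (x : ℝ) ≤ γ i ∧ (T : ℝ) ≤ 2 * (lo i : ℝ) + ((hi i : ℝ) - lo i) * γ i)

namespace LawDec

/-- lattice bookkeeping with an upper end: `Σ_{h ≤ r·k} [k ∣ h ∧ J₁·k ≤ h < J₀·k]·μ h = Σ_{J₁ ≤ j < J₀} μ(j·k)` (`k ≥ 1`, `J₀ ≤ r + 1`). [folklore] -/
theorem sum_lattice_window₂ (k r J₁ J₀ : ℕ) (hk : 0 < k) (hJ₀ : J₀ ≤ r + 1) (μ : ℕ → ℝ) :
    ∑ h ∈ Finset.range (r * k + 1), (if k ∣ h ∧ J₁ * k ≤ h ∧ h < J₀ * k then μ h else 0)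
      = ∑ j ∈ Finset.Ico J₁ J₀, μ (j * k) := by
  rw [sum_range_mul_eq_sum_multiples k hk (fun h => if k ∣ h ∧ J₁ * k ≤ h ∧ h < J₀ * k then μ h else 0)
    (fun l hl => by rw [if_neg (fun h => hl h.1)]) r]
  have e : ∀ j ∈ Finset.range (r + 1),
      (if k ∣ j * k ∧ J₁ * k ≤ j * k ∧ j * k < J₀ * k then μ (j * k) else 0) = (if J₁ ≤ j ∧ j < J₀ then μ (j * k) else 0) := by
    intro j _
    by_cases hj : J₁ ≤ j ∧ j < J₀
    · rw [if_pos ⟨Dvd.intro_left j rfl, Nat.mul_le_mul_right k hj.1, Nat.mul_lt_mul_of_pos_right hj.2 hk⟩, if_pos hj]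
    · rw [if_neg (fun h => hj ⟨Nat.le_of_mul_le_mul_right h.2.1 hk, Nat.lt_of_mul_lt_mul_right h.2.2⟩), if_neg hj]
  rw [Finset.sum_congr rfl e, ← Finset.sum_filter]
  congr 1
  ext j
  simp only [Finset.mem_filter, Finset.mem_range, Finset.mem_Ico]
  omega

/-- **THE TWO-LOW CELL AT THE FLOOR GATE.**  See the file header. [this work] -/
theorem heavy_binomial_twoLow_floor (k r J₁ J₀ : ℕ) (hk : 0 < k) {g x T' : ℝ} (hg0 : 0 < g) (hg1 : g < 1)
    (hx0 : 0 < x) (hx1 : x < 1) (hT2 : 2 < T') (hT4 : T' ≤ 4) (hJ₁ : 2 ≤ J₁) (hJ₁₀ : J₁ < J₀) (hJ₀r : J₀ ≤ r)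
    (hJ₀x : T' ≤ x * J₀) (hJ₁x : T' - 2 ≤ x * ((J₁ : ℝ) - 1))
    (hcap0 : x * blobLaw (List.replicate r (k, g)) 0
      ≤ (1 - x) * ∑ j ∈ Finset.Ico J₀ (r + 1), blobLaw (List.replicate r (k, g)) (j * k))
    (hcap1 : x * blobLaw (List.replicate r (k, g)) k
      ≤ (1 - x) * ∑ j ∈ Finset.Ico J₁ J₀, blobLaw (List.replicate r (k, g)) (j * k)) :
    HEAVY[x, (k : ℝ) * T', r * k, blobLaw (List.replicate r (k, g))] := by
  classical
  set μ := blobLaw (List.replicate r (k, g)) with hμdef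
  have hk' : (0 : ℝ) < k := by exact_mod_cast hk
  have hgates : ∀ p ∈ List.replicate r (k, g), 0 ≤ p.2 ∧ p.2 ≤ 1 := fun p hp => by
    rw [List.eq_of_mem_replicate hp]; exact ⟨hg0.le, hg1.le⟩
  have hμ0 : ∀ h, 0 ≤ μ h := blobLaw_nonneg _ hgates
  have htop : blobTop (List.replicate r (k, g)) = r * k := blobTop_replicate r k g
  have hμM : ∀ h, r * k < h → μ h = 0 := fun h hh => blobLaw_eq_zero _ h (by rw [htop]; exact hh)
  have hμ1 : ∑ h ∈ Finset.range (r * k + 1), μ h = 1 := by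
    have h1 := sum_blobLaw (List.replicate r (k, g)); rwa [htop] at h1
  have hdvd : ∀ h, ¬ k ∣ h → μ h = 0 := fun h hh =>
    blobLaw_eq_zero_of_not_dvd k _ (fun p hp => by rw [List.eq_of_mem_replicate hp]) h hh
  -- lattice masses are positive
  have hpos : ∀ j, j ≤ r → 0 < μ (j * k) := by
    intro j hj
    rw [hμdef, blobLaw_replicate k hk g r j]
    have : (0 : ℝ) < (r.choose j : ℝ) := by exact_mod_cast Nat.choose_pos hj
    have hq : 0 < 1 - g := by linarith
    positivity
  -- the only low atoms are `0` and `k`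
  have hsl : ∀ h : ℕ, h ≠ 0 → h ≠ k → 2 * (h : ℝ) < (k : ℝ) * T' → μ h = 0 := by
    intro h hh0 hhk hhT
    by_cases hd : k ∣ h
    · exfalso
      obtain ⟨j, rfl⟩ := hd
      have hj : 2 ≤ j := by
        rcases Nat.lt_or_ge j 2 with h2 | h2
        · interval_cases j
          · simp at hh0
          · simp at hhk
        · exact h2
      have : (k : ℝ) * 4 ≤ 2 * ((k * j : ℕ) : ℝ) := by
        push_cast
        have : (2 : ℝ) ≤ j := by exact_mod_cast hj
        nlinarith
      nlinarith
    · exact hdvd h hd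
  -- capacities
  set Cap₀ := ∑ j ∈ Finset.Ico J₀ (r + 1), μ (j * k) with hCap₀
  set Cap₁ := ∑ j ∈ Finset.Ico J₁ J₀, μ (j * k) with hCap₁
  have hC₀ : 0 < Cap₀ := by
    have hmem : J₀ ∈ Finset.Ico J₀ (r + 1) := Finset.mem_Ico.2 ⟨le_rfl, Nat.lt_succ_of_le hJ₀r⟩
    exact lt_of_lt_of_le (hpos J₀ hJ₀r) (Finset.single_le_sum (fun j _ => hμ0 (j * k)) hmem)
  have hC₁ : 0 < Cap₁ := by
    have hmem : J₁ ∈ Finset.Ico J₁ J₀ := Finset.mem_Ico.2 ⟨le_rfl, hJ₁₀⟩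
    exact lt_of_lt_of_le (hpos J₁ (by omega)) (Finset.single_le_sum (fun j _ => hμ0 (j * k)) hmem)
  have h1x : 0 < 1 - x := by linarith
  set c₀ := μ 0 / ((1 - x) * Cap₀) with hc₀
  set c₁ := μ k / ((1 - x) * Cap₁) with hc₁
  have hc₀0 : 0 ≤ c₀ := div_nonneg (hμ0 0) (mul_pos h1x hC₀).le
  have hc₁0 : 0 ≤ c₁ := div_nonneg (hμ0 k) (mul_pos h1x hC₁).le
  have hc₀x : c₀ * x ≤ 1 := by
    rw [hc₀, div_mul_eq_mul_div, div_le_one (mul_pos h1x hC₀)]; linarith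
  have hc₁x : c₁ * x ≤ 1 := by
    rw [hc₁, div_mul_eq_mul_div, div_le_one (mul_pos h1x hC₁)]; linarith
  have hk0 : (0 : ℕ) ≠ k := (Nat.pos_iff_ne_zero.1 hk).symm
  -- the weight table
  let w : ℕ → ℕ → ℝ := fun l h =>
    if l = 0 ∧ (k ∣ h ∧ J₀ * k ≤ h) ∧ h ≤ r * k then c₀ * μ h
    else if l = k ∧ (k ∣ h ∧ J₁ * k ≤ h ∧ h < J₀ * k) then c₁ * μ h else 0
  have hw0 : ∀ h, w 0 h = if (k ∣ h ∧ J₀ * k ≤ h) ∧ h ≤ r * k then c₀ * μ h else 0 := by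
    intro h
    show (if 0 = 0 ∧ (k ∣ h ∧ J₀ * k ≤ h) ∧ h ≤ r * k then c₀ * μ h
      else if 0 = k ∧ (k ∣ h ∧ J₁ * k ≤ h ∧ h < J₀ * k) then c₁ * μ h else 0) = _
    rw [if_neg (show ¬ (0 = k ∧ (k ∣ h ∧ J₁ * k ≤ h ∧ h < J₀ * k)) from fun h' => hk0 h'.1)]
    by_cases hc : (k ∣ h ∧ J₀ * k ≤ h) ∧ h ≤ r * k
    · rw [if_pos (show 0 = 0 ∧ (k ∣ h ∧ J₀ * k ≤ h) ∧ h ≤ r * k from ⟨rfl, hc⟩), if_pos hc]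
    · rw [if_neg (show ¬ (0 = 0 ∧ (k ∣ h ∧ J₀ * k ≤ h) ∧ h ≤ r * k) from fun h' => hc h'.2), if_neg hc]
  have hwk : ∀ h, w k h = if k ∣ h ∧ J₁ * k ≤ h ∧ h < J₀ * k then c₁ * μ h else 0 := by
    intro h
    show (if k = 0 ∧ (k ∣ h ∧ J₀ * k ≤ h) ∧ h ≤ r * k then c₀ * μ h
      else if k = k ∧ (k ∣ h ∧ J₁ * k ≤ h ∧ h < J₀ * k) then c₁ * μ h else 0) = _
    rw [if_neg (show ¬ (k = 0 ∧ (k ∣ h ∧ J₀ * k ≤ h) ∧ h ≤ r * k) from fun h' => hk0.symm h'.1)]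
    by_cases hc : k ∣ h ∧ J₁ * k ≤ h ∧ h < J₀ * k
    · rw [if_pos (show k = k ∧ (k ∣ h ∧ J₁ * k ≤ h ∧ h < J₀ * k) from ⟨rfl, hc⟩), if_pos hc]
    · rw [if_neg (show ¬ (k = k ∧ (k ∣ h ∧ J₁ * k ≤ h ∧ h < J₀ * k)) from fun h' => hc h'.2), if_neg hc]
  have hwl : ∀ l h, l ≠ 0 → l ≠ k → w l h = 0 := by
    intro l h hl0 hlk; simp only [w]
    rw [if_neg (fun h' => hl0 h'.1), if_neg (fun h' => hlk h'.1)]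
  refine heavy_of_pairWeights x ((k : ℝ) * T') (r * k) μ w (fun _ _ => x) hx0.le hx1.le hμM hμ1 (fun l h => ?_) ?_ ?_ ?_
  · -- nonnegative weights
    simp only [w]; split_ifs
    · exact mul_nonneg hc₀0 (hμ0 h)
    · exact mul_nonneg hc₁0 (hμ0 h)
    · exact le_rfl
  · -- support conditions
    intro l h hw
    by_cases hl0 : l = 0
    · subst hl0
      rw [hw0] at hw
      split_ifs at hw with hcond
      · obtain ⟨⟨⟨j, rfl⟩, hJj⟩, hjr⟩ := hcond
        have hJj' : J₀ ≤ j := Nat.le_of_mul_le_mul_right (by rwa [Nat.mul_comm k j] at hJj) hk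
        have hj0 : 0 < j := by omega
        refine ⟨by simp only [Nat.cast_zero, mul_zero]; nlinarith, Nat.mul_pos hk hj0, hjr, le_rfl, hx1.le, ?_⟩
        have hJj'' : (J₀ : ℝ) ≤ j := by exact_mod_cast hJj'
        have h1 : (k : ℝ) * T' ≤ (k : ℝ) * (x * J₀) := mul_le_mul_of_nonneg_left hJ₀x hk'.le
        have h2 : (k : ℝ) * (x * J₀) ≤ (k : ℝ) * (x * j) :=
          mul_le_mul_of_nonneg_left (mul_le_mul_of_nonneg_left hJj'' hx0.le) hk'.le
        push_cast
        linarith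
      · exact absurd hw (lt_irrefl 0)
    · by_cases hlk : l = k
      · rw [hlk] at hw ⊢
        rw [hwk] at hw
        split_ifs at hw with hcond
        · obtain ⟨⟨j, rfl⟩, hJj, hjJ⟩ := hcond
          have hJj' : J₁ ≤ j := Nat.le_of_mul_le_mul_right (by rwa [Nat.mul_comm k j] at hJj) hk
          have hjJ' : j < J₀ := Nat.lt_of_mul_lt_mul_right (a := k) (by rwa [Nat.mul_comm k j] at hjJ)
          have hj2 : 2 ≤ j := hJ₁.trans hJj'
          refine ⟨?_, ?_, ?_, le_rfl, hx1.le, ?_⟩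
          · nlinarith
          · have h2 := Nat.mul_le_mul_left k hj2
            omega
          · rw [Nat.mul_comm]; exact Nat.mul_le_mul_right k (by omega)
          · have hJj'' : (J₁ : ℝ) - 1 ≤ (j : ℝ) - 1 := by
              have : (J₁ : ℝ) ≤ j := by exact_mod_cast hJj'
              linarith
            have h1 : (k : ℝ) * (T' - 2) ≤ (k : ℝ) * (x * ((J₁ : ℝ) - 1)) := mul_le_mul_of_nonneg_left hJ₁x hk'.le
            have h2 : (k : ℝ) * (x * ((J₁ : ℝ) - 1)) ≤ (k : ℝ) * (x * ((j : ℝ) - 1)) :=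
              mul_le_mul_of_nonneg_left (mul_le_mul_of_nonneg_left hJj'' hx0.le) hk'.le
            push_cast
            linarith
        · exact absurd hw (lt_irrefl 0)
      · rw [hwl l h hl0 hlk] at hw; exact absurd hw (lt_irrefl 0)
  · -- lows shipped exactly
    intro l hl hlow
    by_cases hl0 : l = 0
    · subst hl0
      have e : ∀ h ∈ Finset.range (r * k + 1), w 0 h * (1 - x) = (1 - x) * c₀ * (if k ∣ h ∧ J₀ * k ≤ h then μ h else 0) := by
        intro h hh
        have hhr : h ≤ r * k := Nat.lt_succ_iff.1 (Finset.mem_range.1 hh)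
        rw [hw0]
        by_cases hcond : k ∣ h ∧ J₀ * k ≤ h
        · rw [if_pos (show (k ∣ h ∧ J₀ * k ≤ h) ∧ h ≤ r * k from ⟨hcond, hhr⟩), if_pos hcond]; ring
        · rw [if_neg (show ¬ ((k ∣ h ∧ J₀ * k ≤ h) ∧ h ≤ r * k) from fun h' => hcond h'.1), if_neg hcond]; ring
      rw [Finset.sum_congr rfl e, ← Finset.mul_sum, sum_lattice_window k r J₀ hk μ, ← hCap₀, hc₀]
      field_simp
    · by_cases hlk : l = k
      · rw [hlk]
        have e : ∀ h ∈ Finset.range (r * k + 1),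
            w k h * (1 - x) = (1 - x) * c₁ * (if k ∣ h ∧ J₁ * k ≤ h ∧ h < J₀ * k then μ h else 0) := by
          intro h _
          rw [hwk]
          by_cases hcond : k ∣ h ∧ J₁ * k ≤ h ∧ h < J₀ * k
          · rw [if_pos hcond, if_pos hcond]; ring
          · rw [if_neg hcond, if_neg hcond]; ring
        rw [Finset.sum_congr rfl e, ← Finset.mul_sum, sum_lattice_window₂ k r J₁ J₀ hk (by omega) μ, ← hCap₁, hc₁]
        field_simp
      · rw [hsl l hl0 hlk hlow]
        exact Finset.sum_eq_zero fun h _ => by rw [hwl l h hl0 hlk, zero_mul]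
  · -- highs loaded by at most their mass
    intro h hh _
    have hkr : k ∈ Finset.range (r * k + 1) := Finset.mem_range.2 (by nlinarith)
    rw [Finset.sum_eq_add_of_mem (0 : ℕ) k (Finset.mem_range.2 (Nat.succ_pos _)) hkr hk0 (fun l _ hl => by
      rw [hwl l h hl.1 hl.2, zero_mul])]
    rw [hw0, hwk]
    by_cases hA : (k ∣ h ∧ J₀ * k ≤ h) ∧ h ≤ r * k
    · rw [if_pos hA, if_neg (fun h' => absurd h'.2.2 (not_lt.2 hA.1.2)), zero_mul, add_zero]
      calc c₀ * μ h * x = (c₀ * x) * μ h := by ring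
        _ ≤ 1 * μ h := mul_le_mul_of_nonneg_right hc₀x (hμ0 h)
        _ = μ h := one_mul _
    · rw [if_neg hA, zero_mul, zero_add]
      split_ifs
      · calc c₁ * μ h * x = (c₁ * x) * μ h := by ring
          _ ≤ 1 * μ h := mul_le_mul_of_nonneg_right hc₁x (hμ0 h)
          _ = μ h := one_mul _
      · rw [zero_mul]; exact hμ0 h

end LawDec
end Quant
end Summit.CriticalPhenomena.PercolationContinuityZ3.Theorems
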